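import Literature.MathematicalPhysics.QuantumFieldTheory.Balaban1983to89.B9Eq315QkSingleBondTwoBackgroundLetter
import Literature.MathematicalPhysics.QuantumFieldTheory.Balaban1983to89.B9Eq326G1kSupRowClosed
import Literature.MathematicalPhysics.QuantumFieldTheory.Balaban1983to89.B9Eq326G1SupRowOfLetters

/-!
# `Balaban1983to89.B9Eq382BondPenaltyTwoBackgroundLetterTower` — T. Bałaban, *Propagators for lattice gauge theories in a background field*, Commun. Math. Phys. **99** (1985)
# 389–434 [Balaban1985BackgroundPropagators] (3.82) p. 407 *«… + F₂*(A)aQ(U) + Q*(U)aF₂(A) + F₂*(A)aF₂(A) = Δ_a(U) − V₃(A) − P₁(A) − P₂(A)»*, (3.78)–(3.79) p. 406 *«Q(exp(iB)V) = Q(V) + F₂(B)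
# and |F₂(B)B′| ≤ O(1) sup|B| Q″|B′|»*, (3.84)–(3.86) p. 407 *«G(U^η) = G(1)(I − V G(1))⁻¹ … the operators V G(1) … have small norms»*, (3.26) p. 395, (3.15)–(3.16) p. 393, Thm 3.3 p. 399:
# **THE PENALTY PIECE `a·(Q_k(U)†Q_k(U) − Q_k(1)†Q_k(1))∘G₁,k(1)` OF THE TWO-BACKGROUND SPLIT OF `Δ_{a,k}` AT THE NE9 CHAIN, AS A LOCAL LETTER WITH THE SMALL FACTOR `α`,
# CONSTANTS BEFORE THE LATTICE** — for a source `f` supported on the fine bonds of one big block `Π⁻¹(v)` with `‖f‖_∞ ≤ F`: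
# `‖(Q_k(U)†(aQ_k(U)G₁,k(1)f) − Q_k(1)†(aQ_k(1)G₁,k(1)f))(b)‖ ≤ K·α·e^{−κ·d_m(Π(b₋), v)}·F`, `∃ α₀ K κ` FIRST, then `∀ n η m U …` (the bond storey's piece (iv))

statement-level skeleton of published theorems with citation tags; proofs where landed; nothing here is a claim about the Yang–Mills mass gap

CITATION HEADER (lean-in-tree rule).  Audit cell `pub-balaban`, sub-cell `t4`, BINDER row NE9; filed by NE9 crux-team LEAF PROVER 01 (`b2b-balaban-t4-ne9-formalise-leaf-01`, gen 100;
ROUTE (J′-G) «bond storey», memo `t4/b2b-balaban-t4-ne9-formalise-leaf-01/g100/ROUTE-JprimeG-BOND-STOREY-g100.md` §B1 piece (iv), §B4).  Imports this lineage's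
`B9Eq315QkSingleBondTwoBackgroundLetter` (the adjoint-difference letter `norm_adjoint_QkW_sub_flat_apply_le_local_diagonal`; through it ne9-leaf-03's
`B9Eq315QkSingleBondLetter.norm_adjoint_QkW_apply_le_local_sharp`, `B9Eq315QkLocalLetter.{local_QkW, QkOfU_apply_eq_zero_of_support}`, the owner's
`B9Eq315QTowerLipschitzProfile.norm_Qtower_sub_flat_apply_le_profile`, `B9Eq315QTowerFlat`), ne9-leaf-03's `B9Eq326G1kSupRowClosed` (the MODEL row `exists_local_letter_G1k` of
`G₁,k`, read here at the VACUUM) and `B9Eq326G1SupRowOfLetters` (`letter_comp`).  Sources READ first-hand in the held text layer `paper:balaban1985-cmp99-background-propagators`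
pp. 405–407 ((3.71)–(3.86)), p. 395 (3.26), p. 393 (3.15)–(3.16); [Balaban1985Averaging] pp. 36–37 (124)–(127), p. 24 through the imports.  NOTHING of print's proofs is
reproduced: [folklore] algebra `Q(U)†aQ(U) − Q(1)†aQ(1) = Q(U)†a(Q(U) − Q(1)) + (Q(U)† − Q(1)†)aQ(1)` + composition BY NAME of landed letters.

WHY THIS FILE (cell context).  The bond storey types the two-background ladder of the `k`-level bond propagator `G₁,k = Δ_{a,k}⁻¹` at the flat base in LOCAL-LETTER currency via
`G(U) − G(1) = G(U)·[Δ(1) − Δ(U)]·G(1)`, `Δ_{a,k} = Δ + D R_k D† + Q_k†aQ_k` ((3.26), `B9Eq326OperatorTower.laplaceAk`).  Pieces landed before this file: the Hessian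
(`B9Eq373BondHessianTwoBackgroundLetterTower`), `D D†` (`B9Eq375BondGradDivTwoBackgroundLetterTower`), the smooth word `D(1 − R_k)D†` (`B9Eq376BondProjWordTwoBackgroundLetterTower`).
THIS file: the penalty piece, in the exact spelling of `laplaceAk`'s last slot (`LinearMap.adjoint Q_k ((a : ℂ) • Q_k x)`), so that the assembly is `letter_add` + `laplaceAK_apply`.

WHAT IS PROVED (sorry-free; proof lane — 0 `def`; [folklore]).
* §1 **`local_QkOfU_sub_flat`**, **`local_QkW_sub_flat`** — the FORWARD two-background letter of the composite averaging on one-block sources: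
  `‖((Q_k(U) − Q_k(1))f)(c)‖ ≤ M_φ′M_φ·Π_{j<k}(1 + 50(d+1)α_j)·102(d+1)²L·(Σ_{j<k} ε_j)·e^{κ}·e^{−κ d_m(c₋, v)}·F` (the owner's sup profile letter + the one-big-block range at
  both backgrounds).
* §2 **`exists_letter_penalty_sub_flat_G1k_one`** — `∃ α₀ K κ > 0` such that for every height `n`, `ηL^{n+1} = 1`, weights `c₀(L^{n+1})^d = c₁`, torus `m ≥ 1`, background `U`
  with `0 ≤ α ≤ α₀`, displayed tower data (`α_j ∈ [0, 1∕64]`, `Σ_{j≤n} α_j ≤ A_Q`, unit-bounded `α_j`-regular level averages `ε_j`-close to `1` with `ε_j ≤ α r^j`), the flat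
  positivity displays, and every one-block source `f`:
  `‖(Q_k(U)†((a:ℂ)•Q_k(U)G₁,k(1)f) − Q_k(1)†((a:ℂ)•Q_k(1)G₁,k(1)f))(b)‖ ≤ K·α·e^{−κ d_m(Π(b₋), v)}·F`, `G₁,k(1) = B9Eq326OperatorTower.G1k` at `U = 1`.
  PROOF: `= (a:ℂ)•[Q_k(U)†((Q_k(U) − Q_k(1))G f) + (Q_k(U)† − Q_k(1)†)(Q_k(1)G f)]`; four `letter_comp`s over the unit lattice (row sum `K_d(κ∕2)`, `torusSum_le`):
  (L)(G₁,k(1); B, δ) (MODEL row at the vacuum) → (L)(Q_k(U) − Q_k(1); C·α) (§1, `Σε_j ≤ α∕(1−r)`, `Π(1+50(d+1)α_j) ≤ e^{50(d+1)A_Q}`) → (L)(Q_k(U)†; M_φ′M_φe^{100d(d+1)L^dA_Q}·2d·e^{κ})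
  (`norm_adjoint_QkW_apply_le_local_sharp` on the diagonal), and (L)(G₁,k(1)) → (L)(Q_k(1); M_φ′M_φe^{κ}) (`local_QkW`) → (L)(Q_k(U)† − Q_k(1)†; C′·α)
  (`norm_adjoint_QkW_sub_flat_apply_le_local_diagonal`).
HONEST SCOPE.  Composition BY NAME on the cell's MODEL row of `G₁,k` (O-NE9-1; #5 UNRULED); constants crude (`L^d`, `e^{100d(d+1)L^dA_Q}`, `K_d(κ∕2)²` — NOT print's); flat base only;
nothing of [B9] Thm 3.3 ∕ 3.4 ∕ Lemma 3.7 asserted; «NE9 ⇐ the named binders»; NE9 NOT PRINTED ∕ NOT PROVED; spine PROVED 0∕9; rung (B)+1 on a finite T⁴ — NOT infinite volume, NOT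
mass gap, NOT BetaPertH, NOT Clay.  HONEST DEPENDENCY: continuum YM on T⁴ ⇐ BetaPertH ∧ nine spine estimates (0/9 proved); BetaPertH ⇐ (D1) ∧ (D4) ∧ CAP+tail; G-an2-4 gates
asym, D1 and NE2/3/4.  NEW file; nothing modified.  Net new unproved facts: 0.
-/

noncomputable section

open scoped InnerProductSpace ComplexConjugate BigOperators

namespace Literature.MathematicalPhysics.QuantumFieldTheory.Balaban1983to89.B9Eq382BondPenaltyTwoBackgroundLetterTower

open B4Sect5Torus (TSite tdist tdist_nonneg tdist_triangle tdist_symm torusSum_le tdist_self)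
open B4Sect5Proof (latticeConst latticeConst_nonneg)
open B9SectCLatticeCarrier (Bond bpos shift unshift)
open B9Eq311L2Pairing (WL2)
open B9Eq319QprimeTorus (blockCoord)
open B7Prop1Explicit (U1 Wcx boxVec)
open B11Eq103H1Complex (SiteL2K BondL2K)
open B9Eq310DeltaPrime (plaqHolU plaqHolU_one)
open B9Eq310HessianOperator (adTransportW)
open B9Eq315QTorus (perCfg cornerSite)
open B9Eq315QTower (towerP UlevOf QkOfU)
open B9Eq315QTowerFlat (perCfg_UlevOf_one_mem_U1 norm_Wcx_UlevOf_one_sub_one_le UlevOf_one)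
open B9Eq316TowerFlatIsOneStep (towerP_eq_fineP_pow siteCast)
open B9Eq326OperatorTower (laplaceAk G1k QkW)
open B9Eq324DeltaPrimeATower (laplacePrimeAk)
open B9Eq349BlockDistanceWeight (tdist_shift_le_one)
open B9Eq315QkLocalLetter (QkOfU_apply_eq_zero_of_support local_QkW)
open B9Eq315QTowerLipschitzProfile (norm_Qtower_sub_flat_apply_le_profile)
open B9Eq315QkSingleBondLetter (norm_adjoint_QkW_apply_le_local_sharp)
open B9Eq315QkSingleBondTwoBackgroundLetter (norm_adjoint_QkW_sub_flat_apply_le_local_diagonal)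
open B9Eq326G1kSupRowClosed (exists_local_letter_G1k)
open B9Eq326G1SupRowOfLetters (letter_comp)

/-! ## §1 The forward two-background letter of the composite averaging on one-block sources -/

section Forward

variable {d : ℕ} (L : ℕ) [NeZero L] (m : Fin d → ℕ) [∀ i, NeZero (m i)]
  {𝔸 : Type*} [NormedRing 𝔸] [NormedAlgebra ℂ 𝔸] [CompleteSpace 𝔸] [NormOneClass 𝔸] (hL : 1 ≤ L) (k : ℕ) (U : Bond d (towerP L m k) → 𝔸ˣ)
  (α : ℕ → ℝ) (hα0 : ∀ j, 0 ≤ α j) (hα1 : ∀ j, α j ≤ 1 / 64)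
  (hU1 : ∀ (j : ℕ) (x : B7Prop1Explicit.Site d) (κ : Fin d), perCfg (towerP L m (j + 1)) (UlevOf L m k U j) x κ ∈ U1 𝔸)
  (hreg : ∀ (j : ℕ) (y : TSite d (towerP L m j)) (κ : Fin d) (r : Fin d → Fin L),
    ‖((Wcx L (perCfg (towerP L m (j + 1)) (UlevOf L m k U j)) (cornerSite L y) κ (boxVec L r) : 𝔸ˣ) : 𝔸) - 1‖ ≤ α j)
  (εU : ℕ → ℝ) (hεU : ∀ j, 0 ≤ εU j) (hUε : ∀ (j : ℕ) (b : Bond d (towerP L m (j + 1))), ‖(UlevOf L m k U j b : 𝔸) - 1‖ ≤ εU j)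

include hα0 hεU hUε in
/-- **`(Q_k(U) − Q_k(1))A` ON A ONE-BLOCK SOURCE CARRIES THE LETTER (L) WITH THE SMALL FACTOR `Σ_j ε_j`** (block of a coarse bond = its base point; `1 ≤ m_i`, `κ ≥ 0`):
for `A` supported on the fine bonds based in `Π⁻¹(v)` with `‖A(b)‖ ≤ a`,
`‖((Q_k(U) − Q_k(1))A)(c)‖ ≤ Π_{j<k}(1 + 50(d+1)α_j)·102(d+1)²L·(Σ_{j<k} ε_j)·e^{κ}·e^{−κ·d_m(c₋,v)}·a` — the owner's sup profile letter
`norm_Qtower_sub_flat_apply_le_profile` on the zone `v ∈ {c₋, c₋ + e_{c.2}}` (`d_m ≤ 1`), zero off it at BOTH backgrounds (`QkOfU_apply_eq_zero_of_support`). [folklore]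
[cite: Balaban1985BackgroundPropagators, (3.15)–(3.16) p.393, (3.78)–(3.79) p.406; Balaban1985Averaging, p.24, (124)–(127) pp.36–37] -/
theorem local_QkOfU_sub_flat (hm : ∀ i, 1 ≤ m i) {κ : ℝ} (hκ : 0 ≤ κ) (v : TSite d m) (A : Bond d (towerP L m k) → 𝔸) {a : ℝ} (ha : 0 ≤ a)
    (hAv : ∀ b, blockCoord (L ^ k) m (siteCast (towerP_eq_fineP_pow L m k) b.1) ≠ v → A b = 0) (hAa : ∀ b, ‖A b‖ ≤ a) (c : Bond d m) :
    ‖QkOfU L m hL k U α hα1 hU1 hreg A c -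
        QkOfU L m hL k (fun _ : Bond d (towerP L m k) => (1 : 𝔸ˣ)) (fun _ => 0) (fun _ => by norm_num)
          (perCfg_UlevOf_one_mem_U1 L m k) (norm_Wcx_UlevOf_one_sub_one_le L m k (fun _ => 0) (fun _ => le_rfl)) A c‖ ≤
      ((∏ j ∈ Finset.range k, (1 + 50 * (d + 1) * α j)) * (102 * (d + 1) ^ 2 * L) * (∑ j ∈ Finset.range k, εU j)) *
        Real.exp κ * Real.exp (-(κ * tdist m c.1 v)) * a := by
  have hP : 0 ≤ ∏ j ∈ Finset.range k, (1 + 50 * ((d : ℝ) + 1) * α j) := Finset.prod_nonneg fun j _ => by have := hα0 j; positivity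
  have hS : 0 ≤ ∑ j ∈ Finset.range k, εU j := Finset.sum_nonneg fun j _ => hεU j
  have hC : 0 ≤ (∏ j ∈ Finset.range k, (1 + 50 * ((d : ℝ) + 1) * α j)) * (102 * ((d : ℝ) + 1) ^ 2 * L) * (∑ j ∈ Finset.range k, εU j) := by
    positivity
  have hsup : ‖QkOfU L m hL k U α hα1 hU1 hreg A c -
        QkOfU L m hL k (fun _ : Bond d (towerP L m k) => (1 : 𝔸ˣ)) (fun _ => 0) (fun _ => by norm_num)
          (perCfg_UlevOf_one_mem_U1 L m k) (norm_Wcx_UlevOf_one_sub_one_le L m k (fun _ => 0) (fun _ => le_rfl)) A c‖ ≤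
      (∏ j ∈ Finset.range k, (1 + 50 * ((d : ℝ) + 1) * α j)) * (102 * ((d : ℝ) + 1) ^ 2 * L) * (∑ j ∈ Finset.range k, εU j) * a :=
    norm_Qtower_sub_flat_apply_le_profile L m hL k U α hα1 hU1 hreg εU hεU hUε k A ha hAa c
  have hcomp : ∀ {D : ℝ}, D ≤ 1 →
      (∏ j ∈ Finset.range k, (1 + 50 * ((d : ℝ) + 1) * α j)) * (102 * ((d : ℝ) + 1) ^ 2 * L) * (∑ j ∈ Finset.range k, εU j) * a ≤
      ((∏ j ∈ Finset.range k, (1 + 50 * ((d : ℝ) + 1) * α j)) * (102 * ((d : ℝ) + 1) ^ 2 * L) * (∑ j ∈ Finset.range k, εU j)) *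
        Real.exp κ * Real.exp (-(κ * D)) * a := fun {D} hD => by
    have h1 : (1 : ℝ) ≤ Real.exp κ * Real.exp (-(κ * D)) := by
      rw [← Real.exp_add]
      exact Real.one_le_exp (by nlinarith [mul_le_mul_of_nonneg_left hD hκ])
    set C : ℝ := (∏ j ∈ Finset.range k, (1 + 50 * ((d : ℝ) + 1) * α j)) * (102 * ((d : ℝ) + 1) ^ 2 * L) * (∑ j ∈ Finset.range k, εU j) with hCdef
    calc C * a = C * a * 1 := (mul_one _).symm
      _ ≤ C * a * (Real.exp κ * Real.exp (-(κ * D))) := mul_le_mul_of_nonneg_left h1 (mul_nonneg hC ha)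
      _ = C * Real.exp κ * Real.exp (-(κ * D)) * a := by ring
  by_cases h1 : c.1 = v
  · rw [h1, tdist_self]
    exact hsup.trans (hcomp zero_le_one)
  · by_cases h2 : shift c.2 c.1 = v
    · have hD : tdist m c.1 v ≤ 1 := by rw [← h2]; exact tdist_shift_le_one hm c.1 c.2
      exact hsup.trans (hcomp hD)
    · rw [QkOfU_apply_eq_zero_of_support L m hL k U α hα1 hU1 hreg v A hAv c h1 h2,
        QkOfU_apply_eq_zero_of_support L m hL k _ _ _ _ _ v A hAv c h1 h2, sub_zero, norm_zero]
      positivity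

end Forward

section ForwardChain

variable {d : ℕ} (L : ℕ) [NeZero L] (m : Fin d → ℕ) [∀ i, NeZero (m i)] (n : ℕ)
  {𝔸 : Type*} [NormedRing 𝔸] [NormedAlgebra ℂ 𝔸] [CompleteSpace 𝔸] [NormOneClass 𝔸]
  {W : Type*} [NormedAddCommGroup W] [InnerProductSpace ℂ W] (φ : W ≃ₗ[ℂ] 𝔸) {c₀ c₁ : ℝ}
  (U : Bond d (towerP L m (n + 1)) → 𝔸ˣ) (hL : 1 ≤ L) (α : ℕ → ℝ) (hα0 : ∀ j, 0 ≤ α j) (hα1 : ∀ j, α j ≤ 1 / 64)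
  (hU1 : ∀ (j : ℕ) (x : B7Prop1Explicit.Site d) (κ : Fin d), perCfg (towerP L m (j + 1)) (UlevOf L m (n + 1) U j) x κ ∈ U1 𝔸)
  (hreg : ∀ (j : ℕ) (y : TSite d (towerP L m j)) (κ : Fin d) (r : Fin d → Fin L),
    ‖((Wcx L (perCfg (towerP L m (j + 1)) (UlevOf L m (n + 1) U j)) (cornerSite L y) κ (boxVec L r) : 𝔸ˣ) : 𝔸) - 1‖ ≤ α j)
  (εU : ℕ → ℝ) (hεU : ∀ j, 0 ≤ εU j) (hUε : ∀ (j : ℕ) (b : Bond d (towerP L m (j + 1))), ‖(UlevOf L m (n + 1) U j b : 𝔸) - 1‖ ≤ εU j)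
  {Mφ Mφ' : ℝ} (hφ : ∀ w, ‖φ w‖ ≤ Mφ * ‖w‖) (hφ' : ∀ X, ‖φ.symm X‖ ≤ Mφ' * ‖X‖) (hMφ : 0 ≤ Mφ) (hMφ' : 0 ≤ Mφ')

include hα0 hεU hUε hφ hφ' hMφ hMφ' in
/-- **THE FORWARD TWO-BACKGROUND LETTER OF THE CHAIN's `Q_{n+1}(U) − Q_{n+1}(1) = QkW U − QkW 1`** (fibre read along `φ`): for `f` supported on the fine bonds based in the big
block `Π⁻¹(v)` with `‖f(b)‖ ≤ F` (`0 ≤ F`), every `κ ≥ 0` and every unit-lattice bond `c`,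
`‖(Q_k(U)f)(c) − (Q_k(1)f)(c)‖ ≤ M_φ′M_φ·Π_{j≤n}(1 + 50(d+1)α_j)·102(d+1)²L·(Σ_{j≤n} ε_j)·e^{κ}·e^{−κ·d_m(c₋,v)}·F`. [folklore]
[cite: Balaban1985BackgroundPropagators, (3.15)–(3.16) p.393, (3.78)–(3.79) p.406, (3.82) p.407; Balaban1985Averaging, p.24, (124)–(127) pp.36–37] -/
theorem local_QkW_sub_flat (hm : ∀ i, 1 ≤ m i) {κ : ℝ} (hκ : 0 ≤ κ) (v : TSite d m) (f : BondL2K ℂ d (towerP L m (n + 1)) c₀ W) {F : ℝ} (hF : 0 ≤ F)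
    (hfv : ∀ b, blockCoord (L ^ (n + 1)) m (siteCast (towerP_eq_fineP_pow L m (n + 1)) (bpos b)) ≠ v →
      WL2.equiv ℂ (fun _ : Bond d (towerP L m (n + 1)) => c₀) W f b = 0)
    (hfF : ∀ b, ‖WL2.equiv ℂ (fun _ : Bond d (towerP L m (n + 1)) => c₀) W f b‖ ≤ F) (c : Bond d m) :
    ‖WL2.equiv ℂ (fun _ : Bond d m => c₁) W (QkW L m n φ U hL α hα1 hU1 hreg (c₀ := c₀) (c₁ := c₁) f) c -
        WL2.equiv ℂ (fun _ : Bond d m => c₁) W (QkW L m n φ (fun _ : Bond d (towerP L m (n + 1)) => (1 : 𝔸ˣ)) hL (fun _ => 0) (fun _ => by norm_num)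
          (perCfg_UlevOf_one_mem_U1 L m (n + 1)) (norm_Wcx_UlevOf_one_sub_one_le L m (n + 1) (fun _ => 0) (fun _ => le_rfl)) (c₀ := c₀) (c₁ := c₁) f) c‖ ≤
      Mφ' * Mφ * ((∏ j ∈ Finset.range (n + 1), (1 + 50 * (d + 1) * α j)) * (102 * (d + 1) ^ 2 * L) * (∑ j ∈ Finset.range (n + 1), εU j)) *
        Real.exp κ * Real.exp (-(κ * tdist m (bpos c) v)) * F := by
  rw [show WL2.equiv ℂ (fun _ : Bond d m => c₁) W (QkW L m n φ U hL α hα1 hU1 hreg (c₀ := c₀) (c₁ := c₁) f) c =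
      φ.symm (QkOfU L m hL (n + 1) U α hα1 hU1 hreg (fun b => φ (WL2.equiv ℂ (fun _ : Bond d (towerP L m (n + 1)) => c₀) W f b)) c) from rfl,
    show WL2.equiv ℂ (fun _ : Bond d m => c₁) W (QkW L m n φ (fun _ : Bond d (towerP L m (n + 1)) => (1 : 𝔸ˣ)) hL (fun _ => 0) (fun _ => by norm_num)
          (perCfg_UlevOf_one_mem_U1 L m (n + 1)) (norm_Wcx_UlevOf_one_sub_one_le L m (n + 1) (fun _ => 0) (fun _ => le_rfl)) (c₀ := c₀) (c₁ := c₁) f) c =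
      φ.symm (QkOfU L m hL (n + 1) (fun _ : Bond d (towerP L m (n + 1)) => (1 : 𝔸ˣ)) (fun _ => 0) (fun _ => by norm_num)
          (perCfg_UlevOf_one_mem_U1 L m (n + 1)) (norm_Wcx_UlevOf_one_sub_one_le L m (n + 1) (fun _ => 0) (fun _ => le_rfl))
        (fun b => φ (WL2.equiv ℂ (fun _ : Bond d (towerP L m (n + 1)) => c₀) W f b)) c) from rfl, ← map_sub]
  have h := local_QkOfU_sub_flat L m hL (n + 1) U α hα0 hα1 hU1 hreg εU hεU hUε hm hκ v
    (fun b => φ (WL2.equiv ℂ (fun _ : Bond d (towerP L m (n + 1)) => c₀) W f b)) (a := Mφ * F) (by positivity)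
    (fun b hb => by simp only [hfv b hb, map_zero]) (fun b => (hφ _).trans (mul_le_mul_of_nonneg_left (hfF b) hMφ)) c
  calc _ ≤ Mφ' * ‖QkOfU L m hL (n + 1) U α hα1 hU1 hreg (fun b => φ (WL2.equiv ℂ (fun _ : Bond d (towerP L m (n + 1)) => c₀) W f b)) c -
        QkOfU L m hL (n + 1) (fun _ : Bond d (towerP L m (n + 1)) => (1 : 𝔸ˣ)) (fun _ => 0) (fun _ => by norm_num)
          (perCfg_UlevOf_one_mem_U1 L m (n + 1)) (norm_Wcx_UlevOf_one_sub_one_le L m (n + 1) (fun _ => 0) (fun _ => le_rfl))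
          (fun b => φ (WL2.equiv ℂ (fun _ : Bond d (towerP L m (n + 1)) => c₀) W f b)) c‖ := hφ' _
    _ ≤ Mφ' * (((∏ j ∈ Finset.range (n + 1), (1 + 50 * ((d : ℝ) + 1) * α j)) * (102 * ((d : ℝ) + 1) ^ 2 * L) * (∑ j ∈ Finset.range (n + 1), εU j)) *
        Real.exp κ * Real.exp (-(κ * tdist m c.1 v)) * (Mφ * F)) := mul_le_mul_of_nonneg_left h hMφ'
    _ = _ := by rw [bpos]; ring

end ForwardChain

/-! ## §2 The penalty piece as a local letter with the small factor, constants before the lattice -/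

variable {d : ℕ} (hd : 1 ≤ d) (L : ℕ) [NeZero L] (hL : 1 ≤ L) (hL3 : 3 ≤ L)
  {𝔸 : Type*} [NormedRing 𝔸] [NormedAlgebra ℂ 𝔸] [CompleteSpace 𝔸] [NormOneClass 𝔸] [StarRing 𝔸] [NormedStarGroup 𝔸] [StarModule ℂ 𝔸]
  {W : Type*} [NormedAddCommGroup W] [InnerProductSpace ℂ W] [FiniteDimensional ℂ W] (φ : W ≃ₗ[ℂ] 𝔸)
  {Mφ Mφ' : ℝ} (hMφ : 0 ≤ Mφ) (hMφ' : 0 ≤ Mφ') (hφ : ∀ w, ‖φ w‖ ≤ Mφ * ‖w‖) (hφ' : ∀ X, ‖φ.symm X‖ ≤ Mφ' * ‖X‖) (hstar : ∀ X : 𝔸, ‖star X‖ ≤ ‖X‖)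
  {a : ℝ} (ha : 0 < a) {a' : ℝ} (ha' : 0 < a') {r : ℝ} (hr0 : 0 ≤ r) (hr1 : r < 1)
  (τ : 𝔸 →ₗ[ℂ] ℂ) {Cτ : ℝ} (hτ : ∀ X, ‖τ X‖ ≤ Cτ * ‖X‖) (hCτ : 0 ≤ Cτ) {Mτ : ℝ} (hτm : ∀ X Y : 𝔸, ‖τ (X * Y)‖ ≤ Mτ * ‖X‖ * ‖Y‖) (hMτ : 0 ≤ Mτ)
  {ρw : ℝ} (hρw : 0 ≤ ρw)
  (hτ₁ : ∀ X : 𝔸, τ (star X) = conj (τ X)) (hτ₂ : ∀ X Y : 𝔸, τ (X * Y) = τ (Y * X)) (hφτ : ∀ X Y : 𝔸, ⟪φ.symm X, φ.symm Y⟫_ℂ = τ (star X * Y))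
  (AQ : ℝ)

include hd hL hL3 hMφ hMφ' hφ hφ' hstar ha ha' hr0 hr1 hτ hCτ hτm hMτ hρw hτ₁ hτ₂ hφτ in
set_option maxHeartbeats 3200000 in
/-- **THE PENALTY PIECE `a·(Q_k(U)†Q_k(U) − Q_k(1)†Q_k(1))G₁,k(1)` OF THE TWO-BACKGROUND SPLIT OF `Δ_{a,k}`, AS A LOCAL LETTER WITH THE SMALL FACTOR, CONSTANTS BEFORE THE LATTICE** —
see the module docstring (print's `F₂*(A)aQ(U) + Q*(U)aF₂(A) + F₂*(A)aF₂(A)` of (3.82) applied to `G₁,k(1)` of a one-block source, summed as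
`Q_k(U)†a(Q_k(U) − Q_k(1)) + (Q_k(U)† − Q_k(1)†)aQ_k(1)`). [cite: Balaban1985BackgroundPropagators, (3.82) p.407, (3.78)–(3.79) p.406, (3.84)–(3.86) p.407, (3.26) p.395, Thm 3.3 p.399] -/
theorem exists_letter_penalty_sub_flat_G1k_one :
    ∃ α₀ K κ : ℝ, 0 < α₀ ∧ 0 ≤ K ∧ 0 < κ ∧
      ∀ (n : ℕ) (η : ℝ), η * (L : ℝ) ^ (n + 1) = 1 →
      ∀ (c₀ c₁ : ℝ) [Fact (0 < c₀)] [Fact (0 < c₁)], c₀ * ((L : ℝ) ^ (n + 1)) ^ d = c₁ → |η| ^ d / c₀ ≤ ρw →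
      ∀ (m : Fin d → ℕ) [∀ i, NeZero (m i)], (∀ i, 1 ≤ m i) → ∀ (U : Bond d (towerP L m (n + 1)) → 𝔸ˣ) (α : ℝ), 0 ≤ α → α ≤ α₀ →
      ∀ (αU : ℕ → ℝ), (∀ j, 0 ≤ αU j) → ∀ (hα1 : ∀ j, αU j ≤ 1 / 64), (∑ j ∈ Finset.range (n + 1), αU j ≤ AQ) →
        ∀ (hU1 : ∀ (j : ℕ) (x : B7Prop1Explicit.Site d) (k : Fin d), perCfg (towerP L m (j + 1)) (UlevOf L m (n + 1) U j) x k ∈ U1 𝔸)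
        (hreg : ∀ (j : ℕ) (y : TSite d (towerP L m j)) (k : Fin d) (ρ' : Fin d → Fin L),
          ‖((Wcx L (perCfg (towerP L m (j + 1)) (UlevOf L m (n + 1) U j)) (cornerSite L y) k (boxVec L ρ') : 𝔸ˣ) : 𝔸) - 1‖ ≤ αU j),
      ∀ (εU : ℕ → ℝ), (∀ j, 0 ≤ εU j) → (∀ j < n + 1, εU j ≤ α * r ^ j) →
        (∀ (j : ℕ) (bd : Bond d (towerP L m (j + 1))), ‖(UlevOf L m (n + 1) U j bd : 𝔸) - 1‖ ≤ εU j) →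
      ∀ (hpos'₁ : ∀ x : SiteL2K ℂ d (towerP L m (n + 1)) c₀ W, x ≠ 0 →
          0 < RCLike.re ⟪x, laplacePrimeAk L m n φ η (fun _ : Bond d (towerP L m (n + 1)) => (1 : 𝔸ˣ)) a' (c₁ := c₁) x⟫_ℂ)
        (hpos₁ : ∀ x : BondL2K ℂ d (towerP L m (n + 1)) c₀ W, x ≠ 0 →
          0 < RCLike.re ⟪x, laplaceAk L m n φ η (fun _ : Bond d (towerP L m (n + 1)) => (1 : 𝔸ˣ)) hL (fun _ => 0) (fun _ => by norm_num)
            (perCfg_UlevOf_one_mem_U1 L m (n + 1)) (norm_Wcx_UlevOf_one_sub_one_le L m (n + 1) (fun _ => 0) (fun _ => le_rfl)) τ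
            (c₀ := c₀) (c₁ := c₁) a x⟫_ℂ),
      ∀ (v : TSite d m) (f : BondL2K ℂ d (towerP L m (n + 1)) c₀ W) (F : ℝ),
        (∀ b', blockCoord (L ^ (n + 1)) m (siteCast (towerP_eq_fineP_pow L m (n + 1)) (bpos b')) ≠ v →
          WL2.equiv ℂ (fun _ : Bond d (towerP L m (n + 1)) => c₀) W f b' = 0) →
        (∀ b', ‖WL2.equiv ℂ (fun _ : Bond d (towerP L m (n + 1)) => c₀) W f b'‖ ≤ F) →
      ∀ bd : Bond d (towerP L m (n + 1)),
        ‖WL2.equiv ℂ (fun _ : Bond d (towerP L m (n + 1)) => c₀) W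
            (LinearMap.adjoint (QkW L m n φ U hL αU hα1 hU1 hreg (c₀ := c₀) (c₁ := c₁))
                ((a : ℂ) • QkW L m n φ U hL αU hα1 hU1 hreg (c₀ := c₀) (c₁ := c₁)
                  (G1k L m n φ η (fun _ : Bond d (towerP L m (n + 1)) => (1 : 𝔸ˣ)) hL (fun _ => 0) (fun _ => by norm_num)
                    (perCfg_UlevOf_one_mem_U1 L m (n + 1)) (norm_Wcx_UlevOf_one_sub_one_le L m (n + 1) (fun _ => 0) (fun _ => le_rfl)) τ
                    (c₀ := c₀) (c₁ := c₁) hpos₁ f)) -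
              LinearMap.adjoint (QkW L m n φ (fun _ : Bond d (towerP L m (n + 1)) => (1 : 𝔸ˣ)) hL (fun _ => 0) (fun _ => by norm_num)
                  (perCfg_UlevOf_one_mem_U1 L m (n + 1)) (norm_Wcx_UlevOf_one_sub_one_le L m (n + 1) (fun _ => 0) (fun _ => le_rfl)) (c₀ := c₀) (c₁ := c₁))
                ((a : ℂ) • QkW L m n φ (fun _ : Bond d (towerP L m (n + 1)) => (1 : 𝔸ˣ)) hL (fun _ => 0) (fun _ => by norm_num)
                  (perCfg_UlevOf_one_mem_U1 L m (n + 1)) (norm_Wcx_UlevOf_one_sub_one_le L m (n + 1) (fun _ => 0) (fun _ => le_rfl)) (c₀ := c₀) (c₁ := c₁)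
                  (G1k L m n φ η (fun _ : Bond d (towerP L m (n + 1)) => (1 : 𝔸ˣ)) hL (fun _ => 0) (fun _ => by norm_num)
                    (perCfg_UlevOf_one_mem_U1 L m (n + 1)) (norm_Wcx_UlevOf_one_sub_one_le L m (n + 1) (fun _ => 0) (fun _ => le_rfl)) τ
                    (c₀ := c₀) (c₁ := c₁) hpos₁ f))) bd‖ ≤
          K * α * Real.exp (-(κ * tdist m (blockCoord (L ^ (n + 1)) m (siteCast (towerP_eq_fineP_pow L m (n + 1)) (bpos bd))) v)) * F := by
  classical
  -- (0) the MODEL row of `G₁,k` (read at the vacuum below), `∃`-first, and the constants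
  obtain ⟨α₁, B, δ, hα₁, hB, hδ, ROW⟩ := exists_local_letter_G1k hd L hL hL3 φ hMφ hMφ' hφ hφ' hstar ha ha' (ϱ := 1 / 2) (by norm_num) (by norm_num)
    τ hτ hCτ hτm hMτ hρw hτ₁ hτ₂ hφτ 0
  set κ₀ : ℝ := δ with hκ₀
  have hκ₀0 : 0 < κ₀ := hδ
  set S : ℝ := latticeConst d (κ₀ / 2) with hS
  have hS0 : 0 ≤ S := latticeConst_nonneg d (half_pos hκ₀0).le
  have h1r : 0 < 1 - r := by linarith
  set θ : ℝ := 102 * ((d : ℝ) + 1) ^ 2 * L with hθ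
  have hθ0 : 0 ≤ θ := by positivity
  set EA : ℝ := Real.exp (100 * d * (d + 1) * (L : ℝ) ^ d * AQ) with hEA
  set KQ1 : ℝ := Mφ' * Mφ * Real.exp κ₀ with hKQ1
  set KQd : ℝ := Mφ' * Mφ * (Real.exp (50 * ((d : ℝ) + 1) * AQ) * θ * (1 / (1 - r))) * Real.exp κ₀ with hKQd
  set KSU : ℝ := Mφ' * Mφ * EA * ((2 * d : ℕ) : ℝ) * Real.exp κ₀ with hKSU
  set KSd : ℝ := Mφ' * Mφ * ((L : ℝ) ^ d * (2 * d * (102 * ((d : ℝ) + 1) ^ 2 * L)) * (1 / (1 - r)) * EA) * ((2 * d : ℕ) : ℝ) * Real.exp κ₀ with hKSd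
  have hKQ10 : 0 ≤ KQ1 := by positivity
  have hKQd0 : 0 ≤ KQd := by positivity
  have hKSU0 : 0 ≤ KSU := by positivity
  have hKSd0 : 0 ≤ KSd := by positivity
  set K : ℝ := |a| * (B * KQd * S * KSU * S + B * KQ1 * S * KSd * S) with hK
  have hK0 : 0 ≤ K := by positivity
  refine ⟨1, K, κ₀ / 2, one_pos, hK0, half_pos hκ₀0, ?_⟩
  intro n η hηL c₀ c₁ _ _ hw hρ m _ hm U α hα hαle αU hα0U hα1 hAQ hU1 hreg εU hε0 hεr hlev hpos'₁ hpos₁ v f F hfv hfF bd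
  have hF : 0 ≤ F := (norm_nonneg _).trans (hfF bd)
  have hc₀ : (0 : ℝ) < c₀ := Fact.out
  have hLd : (0 : ℝ) < ((L : ℝ) ^ (n + 1)) ^ d := by
    have : (0 : ℝ) < L := by exact_mod_cast hL
    positivity
  haveI : Nonempty (Bond d (towerP L m (n + 1))) := ⟨bd⟩
  haveI : Nonempty (Bond d m) := ⟨(v, bd.2)⟩
  -- names
  set piS : TSite d (towerP L m (n + 1)) → TSite d m := fun x => blockCoord (L ^ (n + 1)) m (siteCast (towerP_eq_fineP_pow L m (n + 1)) x) with hpiS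
  set piB : Bond d (towerP L m (n + 1)) → TSite d m := fun b' => piS (bpos b') with hpiB
  set piC : Bond d m → TSite d m := fun c => c.1 with hpiC
  set G := G1k L m n φ η (fun _ : Bond d (towerP L m (n + 1)) => (1 : 𝔸ˣ)) hL (fun _ => 0) (fun _ => by norm_num)
    (perCfg_UlevOf_one_mem_U1 L m (n + 1)) (norm_Wcx_UlevOf_one_sub_one_le L m (n + 1) (fun _ => 0) (fun _ => le_rfl)) τ (c₀ := c₀) (c₁ := c₁) hpos₁ with hGdef
  set QU := QkW L m n φ U hL αU hα1 hU1 hreg (c₀ := c₀) (c₁ := c₁) with hQU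
  set Q1 := QkW L m n φ (fun _ : Bond d (towerP L m (n + 1)) => (1 : 𝔸ˣ)) hL (fun _ => 0) (fun _ => by norm_num)
    (perCfg_UlevOf_one_mem_U1 L m (n + 1)) (norm_Wcx_UlevOf_one_sub_one_le L m (n + 1) (fun _ => 0) (fun _ => le_rfl)) (c₀ := c₀) (c₁ := c₁) with hQ1
  -- the CLMs entering the four compositions
  obtain ⟨T0, hT0⟩ : ∃ T : BondL2K ℂ d (towerP L m (n + 1)) c₀ W →L[ℂ] BondL2K ℂ d (towerP L m (n + 1)) c₀ W, T = LinearMap.toContinuousLinearMap G := ⟨_, rfl⟩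
  obtain ⟨TQ1, hTQ1⟩ : ∃ T : BondL2K ℂ d (towerP L m (n + 1)) c₀ W →L[ℂ] BondL2K ℂ d m c₁ W, T = LinearMap.toContinuousLinearMap Q1 := ⟨_, rfl⟩
  obtain ⟨TQd, hTQd⟩ : ∃ T : BondL2K ℂ d (towerP L m (n + 1)) c₀ W →L[ℂ] BondL2K ℂ d m c₁ W, T = LinearMap.toContinuousLinearMap (QU - Q1) := ⟨_, rfl⟩
  obtain ⟨SU, hSU⟩ : ∃ T : BondL2K ℂ d m c₁ W →L[ℂ] BondL2K ℂ d (towerP L m (n + 1)) c₀ W, T = LinearMap.toContinuousLinearMap (LinearMap.adjoint QU) := ⟨_, rfl⟩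
  obtain ⟨Sd, hSd⟩ : ∃ T : BondL2K ℂ d m c₁ W →L[ℂ] BondL2K ℂ d (towerP L m (n + 1)) c₀ W,
      T = LinearMap.toContinuousLinearMap (LinearMap.adjoint QU - LinearMap.adjoint Q1) := ⟨_, rfl⟩
  -- (1) the flat class data for the MODEL row at `(fun _ => 1)`, `α := 0`
  have hUε1 : ∀ (j : ℕ) (b' : Bond d (towerP L m (j + 1))), ‖(UlevOf L m (n + 1) (fun _ : Bond d (towerP L m (n + 1)) => (1 : 𝔸ˣ)) j b' : 𝔸) - 1‖ ≤ (fun _ : ℕ => (0 : ℝ)) j :=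
    fun j b' => by rw [UlevOf_one]; simp
  have hLb1 : ∀ (j : ℕ) (b' : Bond d (towerP L m (j + 1))), UlevOf L m (n + 1) (fun _ : Bond d (towerP L m (n + 1)) => (1 : 𝔸ˣ)) j b' ∈ U1 𝔸 := fun j b' => by
    rw [UlevOf_one]; exact one_mem _
  have hRlev1 : ∀ (j : ℕ) (b' : Bond d (towerP L m (j + 1))) (w : W), ‖adTransportW φ (UlevOf L m (n + 1) (fun _ : Bond d (towerP L m (n + 1)) => (1 : 𝔸ˣ)) j) b' w‖ ≤ ‖w‖ :=
    fun j b' w => by rw [UlevOf_one, B5Eq172HodgePositivity.adTransportW_one, LinearMap.id_apply]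
  have hUst1 : ∀ b' : Bond d (towerP L m (n + 1)), star ((fun _ : Bond d (towerP L m (n + 1)) => (1 : 𝔸ˣ)) b' : 𝔸) =
      ((((fun _ : Bond d (towerP L m (n + 1)) => (1 : 𝔸ˣ)) b')⁻¹ : 𝔸ˣ) : 𝔸) := fun _ => by simp
  have hUb1 : ∀ b' : Bond d (towerP L m (n + 1)), (fun _ : Bond d (towerP L m (n + 1)) => (1 : 𝔸ˣ)) b' ∈ U1 𝔸 := fun _ => one_mem _
  have hUη1 : ∀ b' : Bond d (towerP L m (n + 1)), ‖((fun _ : Bond d (towerP L m (n + 1)) => (1 : 𝔸ˣ)) b' : 𝔸) - 1‖ ≤ 0 * η := fun _ => by simp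
  have hpl1 : ∀ p : B9SectCLatticeCarrier.Plaq d (towerP L m (n + 1)), ‖(plaqHolU (fun _ : Bond d (towerP L m (n + 1)) => (1 : 𝔸ˣ)) p : 𝔸) - 1‖ ≤ 0 * η ^ 2 := fun _ => by
    simp [plaqHolU_one]
  have hUgrad1 : ∀ (x : TSite d (towerP L m (n + 1))) (μ : Fin d), ‖((fun _ : Bond d (towerP L m (n + 1)) => (1 : 𝔸ˣ)) (x, μ) : 𝔸) -
      (fun _ : Bond d (towerP L m (n + 1)) => (1 : 𝔸ˣ)) (unshift μ x, μ)‖ ≤ 0 * η ^ 2 := fun _ _ => by simp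
  have hεg1 : ∀ j < n + 1, (fun _ : ℕ => (0 : ℝ)) j ≤ 0 * (1 / 2 : ℝ) ^ j := fun _ _ => by simp
  have hAQ1 : ∑ j ∈ Finset.range (n + 1), (fun _ : ℕ => (0 : ℝ)) j ≤ 0 := by simp
  -- (2) the five letters in `letter_comp` shape
  have hcomp : ∀ {D : ℝ}, D ≤ 1 → (1 : ℝ) ≤ Real.exp κ₀ * Real.exp (-(κ₀ * D)) := fun {D} hD => by
    rw [← Real.exp_add]; exact Real.one_le_exp (by nlinarith [mul_le_mul_of_nonneg_left hD hκ₀0.le])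
  -- (L)(G₁,k(1); B, κ₀)
  have hLG : ∀ (v : TSite d m) (f : BondL2K ℂ d (towerP L m (n + 1)) c₀ W) (F : ℝ), (∀ x, piB x ≠ v → WL2.equiv ℂ (fun _ : Bond d (towerP L m (n + 1)) => c₀) W f x = 0) →
      (∀ x, ‖WL2.equiv ℂ (fun _ : Bond d (towerP L m (n + 1)) => c₀) W f x‖ ≤ F) →
      ∀ b', ‖WL2.equiv ℂ (fun _ : Bond d (towerP L m (n + 1)) => c₀) W (T0 f) b'‖ ≤ B * Real.exp (-(κ₀ * tdist m (piB b') v)) * F := by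
    intro v f F hfv hfF b'
    rw [hT0, LinearMap.coe_toContinuousLinearMap']
    exact ROW n η hηL c₀ c₁ hw hρ m hm (fun _ : Bond d (towerP L m (n + 1)) => (1 : 𝔸ˣ)) (fun _ => 0) (fun _ => le_rfl) (fun _ => by norm_num)
      (perCfg_UlevOf_one_mem_U1 L m (n + 1)) (norm_Wcx_UlevOf_one_sub_one_le L m (n + 1) (fun _ => 0) (fun _ => le_rfl)) (fun _ => 0) (fun _ => le_rfl) hUε1 hLb1
      0 le_rfl hα₁.le hUst1 hUb1 hUη1 hpl1 hUgrad1 hRlev1 hεg1 hAQ1 hpos'₁ hpos₁ v f F hfv hfF b'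
  -- (L)(Q_k(1); KQ1, κ₀)
  have hLQ1 : ∀ (v : TSite d m) (f : BondL2K ℂ d (towerP L m (n + 1)) c₀ W) (F : ℝ), (∀ x, piB x ≠ v → WL2.equiv ℂ (fun _ : Bond d (towerP L m (n + 1)) => c₀) W f x = 0) →
      (∀ x, ‖WL2.equiv ℂ (fun _ : Bond d (towerP L m (n + 1)) => c₀) W f x‖ ≤ F) →
      ∀ c, ‖WL2.equiv ℂ (fun _ : Bond d m => c₁) W (TQ1 f) c‖ ≤ KQ1 * Real.exp (-(κ₀ * tdist m (piC c) v)) * F := by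
    intro v f F hfv hfF c
    rw [hTQ1, LinearMap.coe_toContinuousLinearMap']
    have h := local_QkW L m n φ (fun _ : Bond d (towerP L m (n + 1)) => (1 : 𝔸ˣ)) hL (fun _ => 0) (fun _ => by norm_num)
      (perCfg_UlevOf_one_mem_U1 L m (n + 1)) (norm_Wcx_UlevOf_one_sub_one_le L m (n + 1) (fun _ => 0) (fun _ => le_rfl)) (c₀ := c₀) (c₁ := c₁)
      hφ hφ' hMφ hMφ' hm hκ₀0.le v f F hfv hfF c
    simp only [mul_zero, add_zero, Finset.prod_const_one, mul_one] at h
    exact h.trans (le_of_eq (by rw [hKQ1]))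
  -- (L)(Q_k(U) − Q_k(1); KQd·α, κ₀)
  have hPA : ∏ j ∈ Finset.range (n + 1), (1 + 50 * ((d : ℝ) + 1) * αU j) ≤ Real.exp (50 * ((d : ℝ) + 1) * AQ) := by
    calc ∏ j ∈ Finset.range (n + 1), (1 + 50 * ((d : ℝ) + 1) * αU j) ≤ ∏ j ∈ Finset.range (n + 1), Real.exp (50 * ((d : ℝ) + 1) * αU j) :=
          Finset.prod_le_prod (fun j _ => by have := hα0U j; positivity) fun j _ => by linarith [Real.add_one_le_exp (50 * ((d : ℝ) + 1) * αU j)]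
      _ = Real.exp (50 * ((d : ℝ) + 1) * ∑ j ∈ Finset.range (n + 1), αU j) := by rw [← Real.exp_sum, Finset.mul_sum]
      _ ≤ Real.exp (50 * ((d : ℝ) + 1) * AQ) := Real.exp_le_exp.mpr (mul_le_mul_of_nonneg_left hAQ (by positivity))
  have hSε : ∑ j ∈ Finset.range (n + 1), εU j ≤ α * (1 / (1 - r)) := by
    have h1 : ∑ j ∈ Finset.range (n + 1), εU j ≤ ∑ j ∈ Finset.range (n + 1), α * r ^ j :=
      Finset.sum_le_sum fun j hj => hεr j (Finset.mem_range.mp hj)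
    have h2 : ∑ j ∈ Finset.range (n + 1), α * r ^ j ≤ α * (1 / (1 - r)) := by
      rw [← Finset.mul_sum]
      refine mul_le_mul_of_nonneg_left ?_ hα
      have h := geom_sum_Ico_le_of_lt_one (m := 0) (n := n + 1) hr0 hr1
      rw [pow_zero] at h
      rw [Finset.range_eq_Ico]
      exact h.trans (le_of_eq (by ring))
    exact h1.trans h2
  have hLQd : ∀ (v : TSite d m) (f : BondL2K ℂ d (towerP L m (n + 1)) c₀ W) (F : ℝ), (∀ x, piB x ≠ v → WL2.equiv ℂ (fun _ : Bond d (towerP L m (n + 1)) => c₀) W f x = 0) →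
      (∀ x, ‖WL2.equiv ℂ (fun _ : Bond d (towerP L m (n + 1)) => c₀) W f x‖ ≤ F) →
      ∀ c, ‖WL2.equiv ℂ (fun _ : Bond d m => c₁) W (TQd f) c‖ ≤ (KQd * α) * Real.exp (-(κ₀ * tdist m (piC c) v)) * F := by
    intro v f F hfv hfF c
    have hF : 0 ≤ F := (norm_nonneg _).trans (hfF bd)
    rw [hTQd, LinearMap.coe_toContinuousLinearMap', LinearMap.sub_apply, WL2.equiv_sub, Pi.sub_apply]
    have h := local_QkW_sub_flat L m n φ U hL αU hα0U hα1 hU1 hreg εU hε0 hlev (c₀ := c₀) (c₁ := c₁) hφ hφ' hMφ hMφ' hm hκ₀0.le v f hF hfv hfF c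
    refine h.trans ?_
    have hE0 : 0 ≤ Real.exp κ₀ * Real.exp (-(κ₀ * tdist m (bpos c) v)) * F := by positivity
    calc Mφ' * Mφ * ((∏ j ∈ Finset.range (n + 1), (1 + 50 * ((d : ℝ) + 1) * αU j)) * (102 * ((d : ℝ) + 1) ^ 2 * L) * (∑ j ∈ Finset.range (n + 1), εU j)) *
          Real.exp κ₀ * Real.exp (-(κ₀ * tdist m (bpos c) v)) * F
        = Mφ' * Mφ * ((∏ j ∈ Finset.range (n + 1), (1 + 50 * ((d : ℝ) + 1) * αU j)) * θ * (∑ j ∈ Finset.range (n + 1), εU j)) *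
          (Real.exp κ₀ * Real.exp (-(κ₀ * tdist m (bpos c) v)) * F) := by rw [hθ]; ring
      _ ≤ Mφ' * Mφ * (Real.exp (50 * ((d : ℝ) + 1) * AQ) * θ * (α * (1 / (1 - r)))) * (Real.exp κ₀ * Real.exp (-(κ₀ * tdist m (bpos c) v)) * F) := by
          have hP0 : 0 ≤ ∏ j ∈ Finset.range (n + 1), (1 + 50 * ((d : ℝ) + 1) * αU j) := Finset.prod_nonneg fun j _ => by have := hα0U j; positivity
          have hS0' : 0 ≤ ∑ j ∈ Finset.range (n + 1), εU j := Finset.sum_nonneg fun j _ => hε0 j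
          gcongr
      _ = (KQd * α) * Real.exp (-(κ₀ * tdist m (piC c) v)) * F := by rw [hKQd, hpiC]; simp only [bpos]; ring
  -- (L)(Q_k(U)†; KSU, κ₀) on coarse-bond sources (block of a coarse bond = its base point)
  have hzone : ∀ (w : TSite d m) (h : BondL2K ℂ d m c₁ W) (H : ℝ), (∀ c, piC c ≠ w → WL2.equiv ℂ (fun _ : Bond d m => c₁) W h c = 0) →
      (∀ c, ‖WL2.equiv ℂ (fun _ : Bond d m => c₁) W h c‖ ≤ H) → ∀ (b' : Bond d (towerP L m (n + 1))) (c : Bond d m),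
      (blockCoord (L ^ (n + 1)) m (siteCast (towerP_eq_fineP_pow L m (n + 1)) b'.1) = c.1 ∨
        blockCoord (L ^ (n + 1)) m (siteCast (towerP_eq_fineP_pow L m (n + 1)) b'.1) = shift c.2 c.1) →
      ‖WL2.equiv ℂ (fun _ : Bond d m => c₁) W h c‖ ≤ Real.exp κ₀ * Real.exp (-(κ₀ * tdist m (piB b') w)) * H := by
    intro w h H hhv hhF b' c hc
    have hH : 0 ≤ H := (norm_nonneg _).trans (hhF c)
    by_cases hcw : c.1 = w
    · have hD : tdist m (piB b') w ≤ 1 := by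
        show tdist m (blockCoord (L ^ (n + 1)) m (siteCast (towerP_eq_fineP_pow L m (n + 1)) b'.1)) w ≤ 1
        rcases hc with hc | hc
        · rw [hc, hcw, tdist_self]; exact zero_le_one
        · rw [hc, ← hcw, tdist_symm hm]; exact tdist_shift_le_one hm c.1 c.2
      calc ‖WL2.equiv ℂ (fun _ : Bond d m => c₁) W h c‖ ≤ 1 * H := by rw [one_mul]; exact hhF c
        _ ≤ (Real.exp κ₀ * Real.exp (-(κ₀ * tdist m (piB b') w))) * H := mul_le_mul_of_nonneg_right (hcomp hD) hH
        _ = _ := by ring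
    · rw [hhv c hcw, norm_zero]; positivity
  have hLSU : ∀ (w : TSite d m) (h : BondL2K ℂ d m c₁ W) (H : ℝ), (∀ c, piC c ≠ w → WL2.equiv ℂ (fun _ : Bond d m => c₁) W h c = 0) →
      (∀ c, ‖WL2.equiv ℂ (fun _ : Bond d m => c₁) W h c‖ ≤ H) →
      ∀ b', ‖WL2.equiv ℂ (fun _ : Bond d (towerP L m (n + 1)) => c₀) W (SU h) b'‖ ≤ KSU * Real.exp (-(κ₀ * tdist m (piB b') w)) * H := by
    intro w h H hhv hhF b'
    have hH : 0 ≤ H := (norm_nonneg _).trans (hhF (w, bd.2))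
    rw [hSU, LinearMap.coe_toContinuousLinearMap']
    have hM : 0 ≤ Real.exp κ₀ * Real.exp (-(κ₀ * tdist m (piB b') w)) * H := by positivity
    have h1 := norm_adjoint_QkW_apply_le_local_sharp (c₀ := c₀) (c₁ := c₁) L m n φ U hL αU hα0U hα1 hU1 hreg hMφ hφ hMφ' hφ' hAQ h b' hM
      (hzone w h H hhv hhF b')
    have he : c₁ / c₀ * (Mφ' * ((((L : ℝ) ^ (n + 1)) ^ d)⁻¹ * Real.exp (100 * d * (d + 1) * (L : ℝ) ^ d * AQ)) * Mφ) = Mφ' * Mφ * EA := by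
      rw [hEA, ← hw]; field_simp
    rw [he] at h1
    exact h1.trans (le_of_eq (by rw [hKSU]; ring))
  -- (L)(Q_k(U)† − Q_k(1)†; KSd·α, κ₀)
  have hLSd : ∀ (w : TSite d m) (h : BondL2K ℂ d m c₁ W) (H : ℝ), (∀ c, piC c ≠ w → WL2.equiv ℂ (fun _ : Bond d m => c₁) W h c = 0) →
      (∀ c, ‖WL2.equiv ℂ (fun _ : Bond d m => c₁) W h c‖ ≤ H) →
      ∀ b', ‖WL2.equiv ℂ (fun _ : Bond d (towerP L m (n + 1)) => c₀) W (Sd h) b'‖ ≤ (KSd * α) * Real.exp (-(κ₀ * tdist m (piB b') w)) * H := by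
    intro w h H hhv hhF b'
    have hH : 0 ≤ H := (norm_nonneg _).trans (hhF (w, bd.2))
    rw [hSd, LinearMap.coe_toContinuousLinearMap', LinearMap.sub_apply, WL2.equiv_sub, Pi.sub_apply]
    have hM : 0 ≤ Real.exp κ₀ * Real.exp (-(κ₀ * tdist m (piB b') w)) * H := by positivity
    have h1 := norm_adjoint_QkW_sub_flat_apply_le_local_diagonal L m n φ U hL αU hα0U hα1 hU1 hreg εU hε0 hlev hr0 hr1 hα hεr hMφ hφ hMφ' hφ' hAQ hw h b' hM
      (hzone w h H hhv hhF b')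
    exact h1.trans (le_of_eq (by rw [hKSd, hEA]; ring))
  -- (3) the four compositions (row sum `S = K_d(κ₀/2)`)
  have hrow : ∀ w : TSite d m, ∑ u, Real.exp (-((κ₀ - κ₀ / 2) * tdist m w u)) ≤ S := fun w => by
    rw [show κ₀ - κ₀ / 2 = κ₀ / 2 by ring]; exact torusSum_le d hm (half_pos hκ₀0) w
  have hδ0 : ∀ u v : TSite d m, 0 ≤ tdist m u v := fun u v => tdist_nonneg _ _ _
  have hδt : ∀ u y v : TSite d m, tdist m u v ≤ tdist m u y + tdist m y v := fun u y v => tdist_triangle hm u y v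
  have hκ'0 : (0 : ℝ) ≤ κ₀ / 2 := by positivity
  have hκ'1 : κ₀ / 2 ≤ κ₀ := by linarith
  have hA1 := letter_comp (𝕜 := ℂ) (tdist m) piB piB piC T0 TQd hδ0 hδt hB (mul_nonneg hKQd0 hα) hκ'0 hκ'1 hLG hLQd hrow
  have hA2 := letter_comp (𝕜 := ℂ) (tdist m) piB piC piB (TQd ∘L T0) SU hδ0 hδt (by positivity) hKSU0 hκ'0 le_rfl hA1 hLSU hrow v f F hfv hfF bd
  have hB1 := letter_comp (𝕜 := ℂ) (tdist m) piB piB piC T0 TQ1 hδ0 hδt hB hKQ10 hκ'0 hκ'1 hLG hLQ1 hrow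
  have hB2 := letter_comp (𝕜 := ℂ) (tdist m) piB piC piB (TQ1 ∘L T0) Sd hδ0 hδt (by positivity) (mul_nonneg hKSd0 hα) hκ'0 le_rfl hB1 hLSd hrow v f F hfv hfF bd
  -- (4) the algebraic split of the penalty difference
  have hsplit : LinearMap.adjoint QU ((a : ℂ) • QU (G f)) - LinearMap.adjoint Q1 ((a : ℂ) • Q1 (G f)) =
      (a : ℂ) • ((SU ∘L (TQd ∘L T0)) f + (Sd ∘L (TQ1 ∘L T0)) f) := by
    simp only [ContinuousLinearMap.coe_comp, Function.comp_apply]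
    rw [hT0, hTQ1, hTQd, hSU, hSd]
    simp only [LinearMap.coe_toContinuousLinearMap']
    simp only [LinearMap.sub_apply, map_sub, map_smul, smul_sub, smul_add]
    abel
  rw [hsplit, WL2.equiv_smul, Pi.smul_apply, norm_smul, Complex.norm_real, Real.norm_eq_abs, WL2.equiv_add, Pi.add_apply]
  set E : ℝ := Real.exp (-(κ₀ / 2 * tdist m (piB bd) v)) with hE
  have hsum : ‖WL2.equiv ℂ (fun _ : Bond d (towerP L m (n + 1)) => c₀) W ((SU ∘L (TQd ∘L T0)) f) bd +
        WL2.equiv ℂ (fun _ : Bond d (towerP L m (n + 1)) => c₀) W ((Sd ∘L (TQ1 ∘L T0)) f) bd‖ ≤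
      B * (KQd * α) * S * KSU * S * E * F + B * KQ1 * S * (KSd * α) * S * E * F :=
    (norm_add_le _ _).trans (add_le_add hA2 hB2)
  calc |a| * ‖WL2.equiv ℂ (fun _ : Bond d (towerP L m (n + 1)) => c₀) W ((SU ∘L (TQd ∘L T0)) f) bd +
          WL2.equiv ℂ (fun _ : Bond d (towerP L m (n + 1)) => c₀) W ((Sd ∘L (TQ1 ∘L T0)) f) bd‖
      ≤ |a| * (B * (KQd * α) * S * KSU * S * E * F + B * KQ1 * S * (KSd * α) * S * E * F) := mul_le_mul_of_nonneg_left hsum (abs_nonneg a)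
    _ = K * α * E * F := by rw [hK]; ring

end Literature.MathematicalPhysics.QuantumFieldTheory.Balaban1983to89.B9Eq382BondPenaltyTwoBackgroundLetterTower

end
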